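import Literature.Topology.FourManifolds.HCobordismTransitivity
import Literature.Topology.FourManifolds.CobordismAttachmentProofs
import Literature.Topology.FourManifolds.HomotopySpheresBP
import Literature.AlgebraicTopology.SingularHomology.SingularChains
import HarnessLib

/-!
# A manifold h-cobordant to a boundary bounds a homotopy equivalent filling
# (Wall 1964, §2 p. 146: "filling in the 2-sphere bundle by the 3-disc bundle")

Topic `Literature/Topology/FourManifolds`; in the cone of the named fact
`Literature.Topology.FourManifolds.isHCobordant_of_equivalent_intersectionForm` (**Wall 1964,
Thm. 2**; C. T. C. Wall, *On simply-connected 4-manifolds*, J. London Math. Soc. 39 (1964)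
141–149; `HCobordismDonaldson.lean`, reduced in `HCobordismWallReduction.lean` to Wall's Thm. 1
(`hT1`), Lemma 2 (`hL2`) and the realisation of automorphs on `∂V` (`hreal`)).

Wall proves Thm. 1 (a closed smooth simply connected 4-manifold of signature `0` bounds a
simply connected `W⁵` with `Hₖ(W) = 0`, `k ≥ 3`, `H₂(W)` free) directly only for
`rank H₂(M) ≠ 2` (p. 143) and returns to the exceptional rank on p. 146: "We now return to the
unsettled case of Theorem 1. If the rank of `H₂(M)` is equal to `2`, and `σ(M) = 0`, then the
quadratic form of `M` has one of two types and these are the quadratic forms of `S` and `T`. By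
the result above [Thm. 2 for rank `≠ 1`] `M` is h-cobordant to `S` or `T`, and then **filling in
the 2-sphere bundle `S` (`T`) by the 3-disc bundle, we obtain the required manifold with
boundary `M`**." This file PROVES the filling step in the generality in which it holds: **if
`M` is h-cobordant to `P` and `P = ∂W₀`, then `M = ∂W` for a compact manifold `W ⊇ W₀` onto
which `W` strong deformation retracts** — `W = W₀ ∪_P R` is Milnor's attachment of the
h-cobordism `R` (tree structure `CobordismAttachment`, existence `exists_cobordismAttachment_holds`,
Milnor 1965 Thm. 1.4), and `R` strong deformation retracts onto its end `P`
(`Cobordism.isStrongDeformationRetractOf_range_inl`, Kervaire–Milnor's form of the definition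
of an h-cobordism, `HCobordismTransitivity.lean`), whence so does `W` onto `W₀`
(`IsStrongDeformationRetractOf.union_of_inter_subset`). Consequently `W₀ ↪ W` is a homotopy
equivalence and `W` inherits simple connectivity and all homology groups from `W₀` — in
particular the three properties of Wall's Thm. 1 (`NullCobordism.exists_of_isHCobordant_of_thm1Shape`,
literally the shape of the hypothesis `hT1` of
`isHCobordant_of_equivalent_intersectionForm_of_thm1_lemma2_realisation`).

Everything is proved, in every positive dimension `n + 1`; no definition and no named fact is
introduced (D-0026).

## Main statements

* `NullCobordism.isStrongDeformationRetractOf_range_jW`, `NullCobordism.isHomotopyEquiv_jW` —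
  attaching a cobordism whose incoming end is a homotopy equivalence (an h-cobordism) to a compact
  manifold `W` gives a manifold which strong deformation retracts onto the piece `W`.
* `NullCobordism.exists_of_isHCobordant` — `M ∼ₕ P`, `P = ∂W₀` ⇒ `M = ∂W` with an embedding
  `j : W₀ → W` whose range is a strong deformation retract of `W` (hence a homotopy equivalence).
* `NullCobordism.exists_of_isHCobordant_homology` — the same with the induced isomorphisms
  `Hₖ(W₀) ≅ Hₖ(W)` and `π₁` transported.
* `NullCobordism.exists_of_isHCobordant_of_thm1Shape` — Wall's use: `W₀` simply connected with
  `Hₖ(W₀) = 0` (`k ≥ 3`) and `H₂(W₀)` finitely generated free ⇒ the same for `W`.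

## References

* C. T. C. Wall, *On simply-connected 4-manifolds*, J. London Math. Soc. 39 (1964) 141–149, §2
  p. 146. [WallJLMS1964]
* J. Milnor, *Lectures on the h-cobordism theorem*, Princeton (1965), §1, Thm. 1.4.
  [MilnorHCobordism1965]
* M. Kervaire, J. Milnor, *Groups of homotopy spheres I*, Ann. of Math. (2) 77 (1963), §1
  (p. 504). [KervaireMilnorAnnals1963]
* A. Hatcher, *Algebraic Topology*, CUP (2002), Ch. 0 (p. 3), Cor. 2.11, Prop. 1.18.
  [HatcherAT2002]
-/

noncomputable section

open scoped Manifold ContDiff Topology unitInterval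
open Set Function Topology CategoryTheory CategoryTheory.Limits
open Literature.AlgebraicTopology.Homotopy Literature.AlgebraicTopology.SingularHomology

universe u

namespace Literature.Topology.FourManifolds

namespace NullCobordism

section Attachment

variable {n : ℕ} {W : Type u} [TopologicalSpace W] [ChartedSpace (EuclideanHalfSpace (n + 2)) W]
  {P M : Type u} [TopologicalSpace P] [ChartedSpace (EuclideanSpace ℝ (Fin (n + 1))) P]
  [TopologicalSpace M] [ChartedSpace (EuclideanSpace ℝ (Fin (n + 1))) M]
  {b : BoundaryData (𝓡∂ (n + 2)) W (𝓡 (n + 1))} {X : Cobordism (n + 1) P M}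
  {ψ : b.carrier ≃ₘ⟮𝓡 (n + 1), 𝓡 (n + 1)⟯ P}
  {V : Type u} [TopologicalSpace V] [ChartedSpace (EuclideanHalfSpace (n + 2)) V]

/-- **Attaching an h-cobordism does not change the homotopy type**: if the incoming end
`P ↪ R` of the attached cobordism is a homotopy equivalence (e.g. `R` an h-cobordism), then the
piece `W` is a strong deformation retract of `V = W ∪_ψ R` — `R` strong deformation retracts onto
`inl (P)` (Kervaire–Milnor 1963, §1; `Cobordism.isStrongDeformationRetractOf_range_inl`), and
that deformation pastes with the identity of `W` along the seam `inl (P) ⊆ W`.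
[cite: KervaireMilnorAnnals1963, §1 (p. 504)] [cite: HatcherAT2002, Ch. 0, p. 3] -/
theorem isStrongDeformationRetractOf_range_jW [T2Space V] [CompactSpace W] [CompactSpace P]
    [CompactSpace M] [IsManifold (𝓡 (n + 1)) ∞ P] [IsManifold (𝓡 (n + 1)) ∞ M]
    (A : CobordismAttachment b X ψ V) (hX : IsHomotopyEquiv X.inl) :
    IsStrongDeformationRetractOf (range A.jW) (univ : Set V) := by
  have hjW : IsEmbedding A.jW := A.isSmoothEmbedding_jW.isEmbedding
  have hjX : IsEmbedding A.jX := A.isSmoothEmbedding_jX.isEmbedding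
  -- `R` deformation retracts onto `inl (P)`; transport into `V`
  have hR : IsStrongDeformationRetractOf (A.jX '' range X.inl) (range A.jX) := by
    have := (X.isStrongDeformationRetractOf_range_inl hX).image_of_isEmbedding hjX
    rwa [image_univ] at this
  -- the seam lies in the piece `W`
  have hseam : A.jX '' range X.inl ⊆ range A.jW := by
    rintro _ ⟨_, ⟨p, rfl⟩, rfl⟩
    refine ⟨b.incl (ψ.symm p), ?_⟩
    rw [A.jW_incl, Diffeomorph.apply_symm_apply]
  have hWcl : IsClosed (range A.jW) := (isCompact_range A.continuous_jW).isClosed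
  have hXcl : IsClosed (range A.jX) := (isCompact_range A.continuous_jX).isClosed
  have h := hR.union_of_inter_subset (P := range A.jW)
    (fun v hv => by
      obtain ⟨⟨w, rfl⟩, ⟨x, hx⟩⟩ := hv
      obtain ⟨z, -, rfl⟩ := (A.jW_eq_jX_iff w x).1 hx.symm
      exact ⟨X.inl (ψ z), ⟨ψ z, rfl⟩, hx⟩)
    (fun v hv => hseam hv.1)
    (fun v hv => by rw [hWcl.closure_eq] at hv; exact hv.1)
    (fun v hv => by rw [hXcl.closure_eq] at hv; exact hv.1)
  rwa [A.range_union] at h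

/-- The piece `W ↪ W ∪_ψ R` is a homotopy equivalence when `P ↪ R` is one.
[cite: KervaireMilnorAnnals1963, §1 (p. 504)] [cite: HatcherAT2002, Ch. 0, p. 3] -/
theorem isHomotopyEquiv_jW [T2Space V] [CompactSpace W] [CompactSpace P] [CompactSpace M]
    [IsManifold (𝓡 (n + 1)) ∞ P] [IsManifold (𝓡 (n + 1)) ∞ M]
    (A : CobordismAttachment b X ψ V) (hX : IsHomotopyEquiv X.inl) : IsHomotopyEquiv A.jW :=
  IsHomotopyEquiv.of_isStrongDeformationRetractOf_range A.isSmoothEmbedding_jW.isEmbedding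
    (isStrongDeformationRetractOf_range_jW A hX)

end Attachment

section HCobordant

variable {n : ℕ} {M P : Type u}
  [TopologicalSpace M] [ChartedSpace (EuclideanSpace ℝ (Fin (n + 1))) M]
  [TopologicalSpace P] [ChartedSpace (EuclideanSpace ℝ (Fin (n + 1))) P]

/-- **A manifold h-cobordant to a boundary bounds a homotopy equivalent filling** (Wall 1964, §2,
p. 146: "`M` is h-cobordant to `S` or `T`, and then filling in the 2-sphere bundle `S` (`T`) by
the 3-disc bundle, we obtain the required manifold with boundary `M`"). For closed smooth
manifolds `M ∼ₕ P` of dimension `n + 1` and a null-cobordism `P = ∂W₀`: `M = ∂W` for a compact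
smooth `W` together with an embedding `j : W₀ → W` whose range is a strong deformation retract
of `W`; in particular `j` is a homotopy equivalence. `W = W₀ ∪_P R` for an h-cobordism `R` from
`P` to `M` (Milnor 1965, Thm. 1.4, `exists_cobordismAttachment_holds`).
[cite: WallJLMS1964, §2 p. 146] [cite: MilnorHCobordism1965, §1, Thm. 1.4] -/
theorem exists_of_isHCobordant [IsManifold (𝓡 (n + 1)) ∞ M] [CompactSpace M]
    [IsManifold (𝓡 (n + 1)) ∞ P] [CompactSpace P]
    (h : IsHCobordant (n + 1) M P) (c₀ : NullCobordism (n + 1) P) :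
    ∃ (c : NullCobordism (n + 1) M) (j : c₀.W → c.W), IsEmbedding j ∧
      IsStrongDeformationRetractOf (range j) (univ : Set c.W) ∧ IsHomotopyEquiv j := by
  obtain ⟨X, hX⟩ := h.symm
  obtain ⟨V, _, _, _, _, _, ⟨A⟩⟩ := exists_cobordismAttachment_holds n c₀.W c₀.boundaryData P M X
    (Diffeomorph.refl (𝓡 (n + 1)) P ∞)
  haveI : CompactSpace V := A.compactSpace
  -- `∂(W₀ ∪ R) = M`: the attachment read as a null-cobordism of `M` (Milnor 1965, Thm. 1.4: the
  -- new triad is `(W ∪_h W′; ∅, M)`)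
  let c : NullCobordism (n + 1) M :=
    { W := V
      incl := A.jX ∘ X.inr
      isSmoothEmbedding_incl := A.isSmoothEmbedding_jX_comp_inr
      range_incl := A.range_jX_comp_inr }
  exact ⟨c, A.jW, A.isSmoothEmbedding_jW.isEmbedding,
    isStrongDeformationRetractOf_range_jW A hX.1, isHomotopyEquiv_jW A hX.1⟩

/-- **Homology and fundamental group of the filling**: with `M ∼ₕ P`, `P = ∂W₀` as above,
`M = ∂W` with a homotopy equivalence `j : W₀ → W` (the embedding of the piece), inducing
isomorphisms `Hₖ(W₀; ℤ) ≅ Hₖ(W; ℤ)` for all `k` (Hatcher Cor. 2.11), and `W` simply connected as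
soon as `W₀` is (Hatcher Prop. 1.18). [cite: WallJLMS1964, §2 p. 146] [cite: HatcherAT2002, Cor. 2.11 and Prop. 1.18] -/
theorem exists_of_isHCobordant_homology [IsManifold (𝓡 (n + 1)) ∞ M] [CompactSpace M]
    [IsManifold (𝓡 (n + 1)) ∞ P] [CompactSpace P]
    (h : IsHCobordant (n + 1) M P) (c₀ : NullCobordism (n + 1) P) :
    ∃ (c : NullCobordism (n + 1) M) (j : C(c₀.W, c.W)), IsHomotopyEquiv ⇑j ∧
      (∀ k, IsIso (singularHomology.map ℤ ℤ j k)) ∧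
      (SimplyConnectedSpace c₀.W → SimplyConnectedSpace c.W) := by
  obtain ⟨c, -, -, -, e, -⟩ := exists_of_isHCobordant h c₀
  exact ⟨c, e.toFun, ⟨e, rfl⟩, fun k => (singularHomology.isoOfHomotopyEquiv ℤ ℤ e k).isIso_hom,
    fun _ => e.symm.simplyConnectedSpace⟩

/-- **Wall's use of the filling (1964, p. 146), in the shape of Thm. 1**: if `M ∼ₕ P` and `P`
bounds a compact simply connected `W₀` with `Hₖ(W₀) = 0` for `k ≥ 3` and `H₂(W₀)` finitely
generated free, then `M` bounds a compact simply connected `W` with `Hₖ(W) = 0` for `k ≥ 3` and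
`H₂(W)` finitely generated free — the conclusion of Wall's Thm. 1 for `M` ("we obtain the
required manifold with boundary `M`"), transported along the homotopy equivalence `W₀ ↪ W`.
[cite: WallJLMS1964, §2 p. 146 and Thm. 1 (p. 142)] -/
theorem exists_of_isHCobordant_of_thm1Shape [IsManifold (𝓡 (n + 1)) ∞ M] [CompactSpace M]
    [IsManifold (𝓡 (n + 1)) ∞ P] [CompactSpace P]
    (h : IsHCobordant (n + 1) M P) (c₀ : NullCobordism (n + 1) P)
    (h₁ : SimplyConnectedSpace c₀.W)
    (h₃ : ∀ k : ℕ, 3 ≤ k → IsZero (singularHomology ℤ ℤ c₀.W k))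
    (hfree : Module.Free ℤ (singularHomology ℤ ℤ c₀.W 2))
    (hfin : Module.Finite ℤ (singularHomology ℤ ℤ c₀.W 2)) :
    ∃ c : NullCobordism (n + 1) M, SimplyConnectedSpace c.W ∧
      (∀ k : ℕ, 3 ≤ k → IsZero (singularHomology ℤ ℤ c.W k)) ∧
      Module.Free ℤ (singularHomology ℤ ℤ c.W 2) ∧ Module.Finite ℤ (singularHomology ℤ ℤ c.W 2) := by
  obtain ⟨c, -, -, -, e, -⟩ := exists_of_isHCobordant h c₀
  haveI := h₁
  let ι : ∀ k, singularHomology ℤ ℤ c₀.W k ≅ singularHomology ℤ ℤ c.W k :=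
    fun k => singularHomology.isoOfHomotopyEquiv ℤ ℤ e k
  refine ⟨c, e.symm.simplyConnectedSpace, fun k hk => (h₃ k hk).of_iso (ι k).symm,
    Module.Free.of_equiv (ι 2).toLinearEquiv, ?_⟩
  haveI := hfin
  exact Module.Finite.equiv (ι 2).toLinearEquiv

end HCobordant

end NullCobordism

end Literature.Topology.FourManifolds

end
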